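import Summits.AtomisticToContinuum.Crystallization.Theorems.OverbindingBudgetEnergyHeightsOscCone
import Summits.AtomisticToContinuum.Crystallization.Theorems.ChartedPlanarOrderGapStressVanishes

/-!
# ChartedPlanarOrder · decomp-a2c lens-3 g26 — cone XXXIX: cone XXXVIII with `hV : GapStressVanishesW (17/16)` discharged by theorem

Helper file under `--supports stmt-AtomisticToContinuum-31280` (RDEF = `Theses.OverbindingBudget.RobustDefectLimitWindows`); closes nothing.

Cone XXXIX `rdef_thirtyninth_of_recordK_cert_ref` = lens-4's cone XXXVIII `…OverbindingBudgetEnergyHeightsOscCone.rdef_thirtyeighth_of_recordK_cert_ref`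
with its hypothesis `hV : GapStressVanishesW (17/16)` (slot 7b: a constant transmitted gap stress of a clean, stress-free stacked configuration vanishes)
supplied by the tree theorem ★ `…ChartedPlanarOrderGapStressVanishes.gapStressVanishesW_holds` (method of planes; `IsNash` unused).  All other binders and
side conditions are cone XXXVIII's, verbatim and in the same order.

Mathlib only (+ the two tree modules imported); `[bookkeeping]`; no instances, no notation, sorry-free.
-/

noncomputable section

namespace Summit.AtomisticToContinuum.Crystallization.Theorems.ChartedPlanarOrderGapStressCone

open Summit.AtomisticToContinuum.Crystallization.Theses.OverbindingBudget (RobustDefectLimitWindows)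
open Summit.AtomisticToContinuum.Crystallization.Theses.PricedLinkCensus (ChargedEnergyGap)
open Summit.AtomisticToContinuum.Crystallization.Theorems.ChargedEnergyGapNegative (eStar)
open Summit.AtomisticToContinuum.Crystallization.Theorems.OverbindingBudgetGradedBareness (CleanlessExcessT)
open Summit.AtomisticToContinuum.Crystallization.Theorems.OverbindingBudgetCoherentCut (CoherentResidual)
open Summit.AtomisticToContinuum.Crystallization.Theorems.OverbindingBudgetUniformCutStatements (GrossCleanBallsU)
open Summit.AtomisticToContinuum.Crystallization.Theorems.OverbindingBudgetElasticSplitScale (CompressedVirialLaw)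
open Summit.AtomisticToContinuum.Crystallization.Theorems.OverbindingBudgetScaleWidening (DoorPeriodicW)
open Summit.AtomisticToContinuum.Crystallization.Theorems.OverbindingBudgetTwoShellShape (TwoShellShape BarlowGluingW)
open Summit.AtomisticToContinuum.Crystallization.Theorems.OverbindingBudgetStackedRigidityW (StackedReductionW)
open Summit.AtomisticToContinuum.Crystallization.Theorems.OverbindingBudgetRegistryCut (RegistryResidual RegistryTube)
open Summit.AtomisticToContinuum.Crystallization.Theorems.OverbindingBudgetRegistryDichotomy (BalancedLocus)
open Summit.AtomisticToContinuum.Crystallization.Theorems.OverbindingBudgetRegistryDichotomyCW (RegistryMetricCW)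
open Summit.AtomisticToContinuum.Crystallization.Theorems.OverbindingBudgetEnergyTubeBox (RegistryPinningP TubeConvexRefP)
open Summit.AtomisticToContinuum.Crystallization.Theorems.OverbindingBudgetEnergyAffineTable (AffineTableT AffineTableS)
open Summit.AtomisticToContinuum.Crystallization.Theorems.OverbindingBudgetEnergyHeightsOsc (CoarseRegistryT CoarseRegistryS ForceCertT ForceCertS)
open Summit.AtomisticToContinuum.Crystallization.Theorems.OverbindingBudgetEnergyHeightsOscCone (rdef_thirtyeighth_of_recordK_cert_ref)
open Summit.AtomisticToContinuum.Crystallization.Theorems.ChartedPlanarOrderGapStressVanishes (gapStressVanishesW_holds)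

/-- **Cone XXXIX** = cone XXXVIII `rdef_thirtyeighth_of_recordK_cert_ref` WITHOUT the hypothesis `hV : GapStressVanishesW (17/16)`, which is now the
tree theorem `gapStressVanishesW_holds` (lens-3 g26, method of planes).  Binders, side conditions and the remaining hypotheses are cone XXXVIII's in
the same order. [this file] -/
theorem rdef_thirtyninth_of_recordK_cert_ref (s₁ s₂ h₀ h₁ τ' τ'' κ' ω₀ ω B : ℝ) (s₀ : ℕ) (hκ' : 0 < κ') (hω : 0 < ω) (hω₀ : 2 * ω₀ ≤ ω)
    (hs₀ : 4 ≤ s₀) (hs₁ : 0 ≤ s₁) (hs : 289 * s₂ ^ 2 ≤ 388 * s₁ ^ 2)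
    (hG : GrossCleanBallsU (1 / 250) 10)
    (hCEG : ChargedEnergyGap) (hC : CompressedVirialLaw (1 / 250) 10) (hS : TwoShellShape (1 / 100) (3 / 50) (1 / 450)) (hB₂ : BarlowGluingW)
    (hD : DoorPeriodicW 2) (hSR : StackedReductionW 2 (17 / 16))
    (hP : RegistryPinningP (17 / 16) (1 / 40) (3 / 16) s₁ s₂ 1 0) (hT : TubeConvexRefP (17 / 16) (1 / 40) s₁ s₂ 1 0)
    (hCT : CoarseRegistryT (17 / 16) h₀ (3 / 20)) (hFT : ForceCertT h₀ (3 / 20) τ' ω₀)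
    (hCS : CoarseRegistryS (17 / 16) h₁ (3 / 20)) (hFS : ForceCertS h₁ (3 / 20) τ'' ω₀)
    (hTT : AffineTableT (17 / 16) s₁ s₂ ω s₀ B (eStar + 2 * κ')) (hTS : AffineTableS (17 / 16) ω s₀ B (eStar + 2 * κ'))
    (hBal : BalancedLocus s₁ s₂ h₀ (1 / 40)) (hR1 : RegistryResidual s₁ s₂ (1 / 250)) (hR2 : RegistryTube s₁ s₂ (1 / 100) 1)
    (hMet : RegistryMetricCW s₁ s₂ (3 / 500)) (hCE : CleanlessExcessT) (hRes : CoherentResidual 10) : RobustDefectLimitWindows :=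
  rdef_thirtyeighth_of_recordK_cert_ref s₁ s₂ h₀ h₁ τ' τ'' κ' ω₀ ω B s₀ hκ' hω hω₀ hs₀ hs₁ hs hG hCEG hC hS hB₂ hD hSR gapStressVanishesW_holds hP hT
    hCT hFT hCS hFS hTT hTS hBal hR1 hR2 hMet hCE hRes

/-- the hypotheses of cone XXXIX do not mention `GapStressVanishesW`: slot 7b is closed by theorem. -/
example : (∀ (s₁ s₂ h₀ h₁ τ' τ'' κ' ω₀ ω B : ℝ) (s₀ : ℕ), 0 < κ' → 0 < ω → 2 * ω₀ ≤ ω → 4 ≤ s₀ → 0 ≤ s₁ → 289 * s₂ ^ 2 ≤ 388 * s₁ ^ 2 →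
    GrossCleanBallsU (1 / 250) 10 → ChargedEnergyGap → CompressedVirialLaw (1 / 250) 10 → TwoShellShape (1 / 100) (3 / 50) (1 / 450) → BarlowGluingW →
    DoorPeriodicW 2 → StackedReductionW 2 (17 / 16) →
    RegistryPinningP (17 / 16) (1 / 40) (3 / 16) s₁ s₂ 1 0 → TubeConvexRefP (17 / 16) (1 / 40) s₁ s₂ 1 0 →
    CoarseRegistryT (17 / 16) h₀ (3 / 20) → ForceCertT h₀ (3 / 20) τ' ω₀ → CoarseRegistryS (17 / 16) h₁ (3 / 20) → ForceCertS h₁ (3 / 20) τ'' ω₀ →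
    AffineTableT (17 / 16) s₁ s₂ ω s₀ B (eStar + 2 * κ') → AffineTableS (17 / 16) ω s₀ B (eStar + 2 * κ') →
    BalancedLocus s₁ s₂ h₀ (1 / 40) → RegistryResidual s₁ s₂ (1 / 250) → RegistryTube s₁ s₂ (1 / 100) 1 →
    RegistryMetricCW s₁ s₂ (3 / 500) → CleanlessExcessT → CoherentResidual 10 → RobustDefectLimitWindows) :=
  rdef_thirtyninth_of_recordK_cert_ref

end Summit.AtomisticToContinuum.Crystallization.Theorems.ChartedPlanarOrderGapStressCone

end
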